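import Summits.QuantumFields.BalabanUV.T4Continuum.Support.NE9LinSizeCurrencyBudgetKP
import Summits.QuantumFields.BalabanUV.T4Continuum.Support.NE9FadingArithmeticRider

/-!
# NE9FadingArithmeticLinProj — leaf N2 ON THE PROJECTED d-CURRENCY FACE E5′-P: what the (w10) factor `(1 + cr·a)` does to the
fading readings of the torus END face in Bałaban's linear size (cell `pub-balaban`, node U3 ∕ spine estimate NE9, rung (B)+1 on a
FIXED finite T⁴; NE9 formalisation crew, unit `b2b-balaban-t4-ne9-formalise-leaf-07` gen 3; companion of `NE9LinSizeEndProj`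
(the face), (w10) `NE9FadingArithmeticRider` (the factor), N2-ter §B `NE9LinSizeCurrencyBudgetKP` (the d-currency budget))

HONEST FRAMING (T4-DAG PAGE 1).  Rung (B)+1 on a fixed finite torus; NOT infinite volume, NOT the mass gap, NOT Clay.  NE9 is
NOT PRINTED and NOT proved; this module is OUR OWN bookkeeping (pure real arithmetic on DISPLAYED binder shapes copied token for
token from `NE9LinSizeEndProj.torus_termSize_ne9_and_fadingMemory_of_linSizeDischargers_margProj`), asserts nothing about
Bałaban's objects, re-wires no END face, introduces no `def`.  HONEST DEPENDENCY: continuum YM on T⁴ ⇐ BetaPertH ∧ nine spine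
estimates (0/9 proved); BetaPertH ⇐ (D1) ∧ (D4) ∧ CAP+tail; G-an2-4 gates asym, D1 and NE2/3/4.

THE LETTERS (E5′-P).  Rate `μ_P = ω + 4·lipbar·(a₁·e^{−a″(ν+1)})·((1 + c)·τ̄)`, `c = cr·aA`; lip floor `hliplb : α4·2^(ν+1+2^ν) ≤ lip
≤ lipbar`; KP smallness `hsmall : (D+1)·(2ε′)·e^{a″(ν+1) + 2^ν(a₁ + log 2)}·2^(ν+1+2^ν) ≤ a₁`; ADDITIVE rate `κ ≤ a″`.
WHAT IS RECORDED (kernel).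
§1 `linSmall_iff` — E5′'s KP smallness IS N2-ter §B's shape `2((D+1)·ε·e^{a″(ν+1)+2^ν a₁}·2^(ν+1+2^ν)) ≤ a₁` at `ε := ε′·2^{2^ν}` (the
   per-cube prefactor slot `a₀ = log 2` of `NE9LinSizeKP.kpClause_of_linSizeDecay` contributes `e^{2^ν log 2} = 2^{2^ν}`).
§2 `fade_necessary_linProj` — fading of `μ_P` REQUIRES `8(D+1)(2^(ν+1+2^ν))²·α4·(ε′2^{2^ν})·((1+c)τ̄) < 1 − ω` (N2-ter §B
   `fade_necessary_lin` BY NAME at `τ̄ := (1+c)τ̄`); `fade_necessary_linProj_floor` — with `1 ≤ c` the necessary polynomial smallness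
   DOUBLES: `16(D+1)(2^(ν+1+2^ν))²·2^{2^ν}·α4·ε′·τ̄ < 1 − ω`; `…_of_readOut` — the floor discharged BY NAME from (w10)'s
   `one_le_readConst_mul_dirSize` (`ReadSize`, `DirSize`, the read-out normalised on the marginal direction); T⁴ (`ν = 4`, `D = 8`):
   `144·2^58·α4·ε′·τ̄ < 1 − ω` (`fade_necessary_linProj_floor_T4`; `144·2^58 = 41505174165846491136`).
§3 `fade_sufficient_linProj` — N2-ter §B's sufficiency at `(1+c)τ̄`: the binders `hsmall` (E5′ shape), `hliplb`, `hlipb` are JOINTLY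
   satisfiable WITH fading under a POLYNOMIAL product condition and print's `e^{(ν+1)a″}`-weighted KP smallness — on E5′-P fading is
   still not an extra exponential smallness; the (w10) factor sits inside the polynomial constant.
§4 the census §8 reading («κ sufficiently large») in kernel, WITH the factor: `fade_linProj_iff_lt_exp` ∕ `fade_linProj_iff_log_lt` —
   for `ω < 1` and a positive product `Π = 4·lipbar·a₁·((1+c)τ̄)`, `μ_P < 1 ↔ log(Π∕(1 − ω)) < a″(ν+1)`: a LOWER bound on the
   decay-weight rate in which `1 + c` enters under the logarithm (`+ log(1+c)∕(ν+1)`; at the floor `c = 1` on T⁴: `+ (log 2)∕5 <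
   0.139`); `fade_linProj_mono` (monotone in `a″`); `fade_linProj_of_kappa_threshold` — with the face's `κ ≤ a″`, the threshold on
   `κ(ν+1)` suffices (TYPE «κ ≥ κ₀», [I] Thm 3 p. 264; [II] p. 18 «for κ sufficiently large»); `floorProduct_M_uniform` — under the
   located SHAPES `α4 ≤ α̂·((L·M)⁴)⁻¹` ([II] p. 20 «(LM)⁴α₄ … bounded by 1») and `c ≤ C·M⁴` (the M⁴-reading (V2) of (w10)'s census
   rider), the floor product is bounded UNIFORMLY in `M ≥ 1`: the κ-threshold does not grow with `M` (print's order «κ ≥ κ₀,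
   M ≥ M(κ)» of [I] Thm 3 is respected under either reading (V1)/(V2)).
CENSUS MEANING.  On the d-currency face in the corrected dictionary the (w10) factor changes pure numbers only: necessary
polynomial smallness ×(1+c) (≥ ×2 at the floor), sufficient one likewise, κ-threshold `+ log(1+c)∕(ν+1)`.  Numbers, T⁴ floor
(`ν = 4`, `ω = 1∕13`, `τ̄ = c_τ·78⁴`, `α̂ = 1`, plain logs, companion census sheet): threshold `a″ ≥ 6.69` (`a₁ = 1`, `c_τ = 1`, `c = 0`)
becomes `6.83` at `c = 1`.

References (TYPE locators only; nothing printed is a hypothesis): T. Bałaban, CMP **109** (1987) [Balaban1987RG1] (1.18) p. 263,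
Thm 3 p. 264, (1.20)–(1.22) p. 264; CMP **116** (1988) [Balaban1988RG2Cluster] (1.26) p. 8, (1.36) p. 9, p. 18 text, p. 20 text,
(2.38) p. 20, (2.41) p. 21.
-/

noncomputable section

namespace Summit.QuantumFields.BalabanUV.T4Continuum.NE9FadingArithmeticLinProj

open Real
open Literature.MathematicalPhysics.QuantumFieldTheory.Balaban1983to89
open Literature.MathematicalPhysics.QuantumFieldTheory.Balaban1983to89.T4OutputRate
open Literature.MathematicalPhysics.QuantumFieldTheory.Balaban1983to89.T4HistoryLipschitzRecursion
open Summit.QuantumFields.BalabanUV.T4Continuum.NE9MarginalProjection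
open Summit.QuantumFields.BalabanUV.T4Continuum.NE9LinSizeCurrencyBudgetKP
open Summit.QuantumFields.BalabanUV.T4Continuum.NE9FadingArithmeticRider

/-! ## §1 E5′'s KP smallness is N2-ter §B's shape at `ε := ε′·2^{2^ν}` -/

/-- `e^{2^ν·log 2} = 2^{2^ν}`. [folklore] -/
theorem exp_two_pow_mul_log_two (ν : ℕ) : Real.exp ((2:ℝ) ^ ν * Real.log 2) = (2:ℝ) ^ (2 ^ ν) := by
  have h : ((2:ℝ) ^ ν) = ((2 ^ ν : ℕ) : ℝ) := by push_cast; rfl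
  rw [h, Real.exp_nat_mul, Real.exp_log (by norm_num : (0:ℝ) < 2)]

/-- The two KP-smallness left-hand sides COINCIDE: E5′'s `(D+1)(2ε′)e^{a″(ν+1)+2^ν(a₁+log 2)}2^(ν+1+2^ν)` equals N2-ter §B's
`2((D+1)·ε·e^{a″(ν+1)+2^ν a₁}·2^(ν+1+2^ν))` at `ε = ε′·2^{2^ν}`. [folklore] -/
theorem linSmall_lhs_eq {ν D : ℕ} (a'' a₁ ε' : ℝ) :
    ((D : ℝ) + 1) * (2 * ε') * Real.exp (a'' * (ν + 1) + 2 ^ ν * (a₁ + Real.log 2)) * 2 ^ (ν + 1 + 2 ^ ν) =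
      2 * (((D : ℝ) + 1) * (ε' * 2 ^ (2 ^ ν)) * Real.exp (a'' * (ν + 1) + 2 ^ ν * a₁) * 2 ^ (ν + 1 + 2 ^ ν)) := by
  have h : Real.exp (a'' * (ν + 1) + 2 ^ ν * (a₁ + Real.log 2)) =
      Real.exp (a'' * (ν + 1) + 2 ^ ν * a₁) * (2:ℝ) ^ (2 ^ ν) := by
    rw [← exp_two_pow_mul_log_two ν, ← Real.exp_add]; ring_nf
  rw [h]; ring

/-- **E5′'s KP SMALLNESS ≡ N2-ter §B's SHAPE at `ε := ε′·2^{2^ν}`** (kernel). [folklore] -/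
theorem linSmall_iff {ν D : ℕ} {a'' a₁ ε' : ℝ} :
    ((D : ℝ) + 1) * (2 * ε') * Real.exp (a'' * (ν + 1) + 2 ^ ν * (a₁ + Real.log 2)) * 2 ^ (ν + 1 + 2 ^ ν) ≤ a₁ ↔
      2 * (((D : ℝ) + 1) * (ε' * 2 ^ (2 ^ ν)) * Real.exp (a'' * (ν + 1) + 2 ^ ν * a₁) * 2 ^ (ν + 1 + 2 ^ ν)) ≤ a₁ := by
  rw [linSmall_lhs_eq]

/-! ## §2 Necessary: the polynomial smallness of N2-ter §B, times `(1 + c)` -/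

/-- **(P′) ON E5′-P AS A NECESSARY CONDITION (kernel; N2-ter §B `fade_necessary_lin` BY NAME at `τ̄ := (1+c)τ̄`).**  Fading of
`μ_P = ω + 4·lipbar·(a₁e^{−a″(ν+1)})·((1+c)τ̄)` under E5′-P's `hliplb`/`hlipb`/`hsmall` REQUIRES
`8(D+1)(2^(ν+1+2^ν))²·α4·(ε′2^{2^ν})·((1+c)τ̄) < 1 − ω`. [folklore] -/
theorem fade_necessary_linProj {ν D : ℕ} {a'' a₁ ε' α4 lip lipbar τbar ω c : ℝ} (hα4 : 0 ≤ α4) (hε' : 0 ≤ ε')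
    (hτbar : 0 ≤ τbar) (ha₁ : 0 ≤ a₁) (hc : 0 ≤ c)
    (hliplb : α4 * 2 ^ (ν + 1 + 2 ^ ν) ≤ lip) (hlipb : lip ≤ lipbar)
    (hsmall : ((D : ℝ) + 1) * (2 * ε') * Real.exp (a'' * (ν + 1) + 2 ^ ν * (a₁ + Real.log 2)) * 2 ^ (ν + 1 + 2 ^ ν) ≤ a₁)
    (hfade : ω + 4 * lipbar * (a₁ * Real.exp (-(a'' * (ν + 1)))) * ((1 + c) * τbar) < 1) :
    8 * ((D : ℝ) + 1) * (2 ^ (ν + 1 + 2 ^ ν)) ^ 2 * α4 * (ε' * 2 ^ (2 ^ ν)) * ((1 + c) * τbar) < 1 - ω :=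
  fade_necessary_lin hα4 (by positivity) (mul_nonneg (by linarith) hτbar) ha₁ hliplb hlipb (linSmall_iff.1 hsmall) hfade

/-- **WITH THE (w10) FLOOR `1 ≤ c` THE NECESSARY POLYNOMIAL SMALLNESS DOUBLES**:
`16(D+1)(2^(ν+1+2^ν))²·2^{2^ν}·α4·ε′·τ̄ < 1 − ω`. [folklore] -/
theorem fade_necessary_linProj_floor {ν D : ℕ} {a'' a₁ ε' α4 lip lipbar τbar ω c : ℝ} (hα4 : 0 ≤ α4) (hε' : 0 ≤ ε')
    (hτbar : 0 ≤ τbar) (ha₁ : 0 ≤ a₁) (hc1 : 1 ≤ c)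
    (hliplb : α4 * 2 ^ (ν + 1 + 2 ^ ν) ≤ lip) (hlipb : lip ≤ lipbar)
    (hsmall : ((D : ℝ) + 1) * (2 * ε') * Real.exp (a'' * (ν + 1) + 2 ^ ν * (a₁ + Real.log 2)) * 2 ^ (ν + 1 + 2 ^ ν) ≤ a₁)
    (hfade : ω + 4 * lipbar * (a₁ * Real.exp (-(a'' * (ν + 1)))) * ((1 + c) * τbar) < 1) :
    16 * ((D : ℝ) + 1) * (2 ^ (ν + 1 + 2 ^ ν)) ^ 2 * 2 ^ (2 ^ ν) * α4 * ε' * τbar < 1 - ω := by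
  have h := fade_necessary_linProj hα4 hε' hτbar ha₁ (by linarith) hliplb hlipb hsmall hfade
  have hX : 0 ≤ 8 * ((D : ℝ) + 1) * (2 ^ (ν + 1 + 2 ^ ν)) ^ 2 * α4 * (ε' * 2 ^ (2 ^ ν)) * τbar := by positivity
  have h2 : 8 * ((D : ℝ) + 1) * (2 ^ (ν + 1 + 2 ^ ν)) ^ 2 * α4 * (ε' * 2 ^ (2 ^ ν)) * τbar * 2 ≤
      8 * ((D : ℝ) + 1) * (2 ^ (ν + 1 + 2 ^ ν)) ^ 2 * α4 * (ε' * 2 ^ (2 ^ ν)) * τbar * (1 + c) :=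
    mul_le_mul_of_nonneg_left (by linarith) hX
  calc 16 * ((D : ℝ) + 1) * (2 ^ (ν + 1 + 2 ^ ν)) ^ 2 * 2 ^ (2 ^ ν) * α4 * ε' * τbar
      = 8 * ((D : ℝ) + 1) * (2 ^ (ν + 1 + 2 ^ ν)) ^ 2 * α4 * (ε' * 2 ^ (2 ^ ν)) * τbar * 2 := by ring
    _ ≤ 8 * ((D : ℝ) + 1) * (2 ^ (ν + 1 + 2 ^ ν)) ^ 2 * α4 * (ε' * 2 ^ (2 ^ ν)) * τbar * (1 + c) := h2
    _ = 8 * ((D : ℝ) + 1) * (2 ^ (ν + 1 + 2 ^ ν)) ^ 2 * α4 * (ε' * 2 ^ (2 ^ ν)) * ((1 + c) * τbar) := by ring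
    _ < 1 - ω := h

/-- **THE FLOOR DISCHARGED BY NAME** ((w10) `NE9FadingArithmeticRider.one_le_readConst_mul_dirSize`): if the read-out `r` has the
per-step size `cr` (`ReadSize`, node U2's (R)), the marginal direction `A` the size `aA` (`DirSize`), the scale-`j` slice of `A` is
admissible and `r` is NORMALISED on it (`r j (A↾j) = 1`, the [dict] content of `ProjInto`), then `c = cr·aA ≥ 1` and the doubled
necessary smallness holds on E5′-P. [cite: Balaban1987RG1, (1.18) p.263 and (1.20)-(1.22) p.264] -/
theorem fade_necessary_linProj_floor_of_readOut {C : Carriers} {Bg : Type} {Adm : Set (Bg → C.Dom → ℝ)}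
    {r : ℕ → (Bg → C.Dom → ℝ) → ℝ} {A : Bg → C.Dom → ℝ} {κ cr aA : ℝ} {j : ℕ}
    (hrs : ReadSize Adm r κ cr) (hA : DirSize A κ aA) (haA : 0 ≤ aA) (hAj : restrictScale j A ∈ Adm)
    (hnorm : r j (restrictScale j A) = 1)
    {ν D : ℕ} {a'' a₁ ε' α4 lip lipbar τbar ω : ℝ} (hα4 : 0 ≤ α4) (hε' : 0 ≤ ε') (hτbar : 0 ≤ τbar) (ha₁ : 0 ≤ a₁)
    (hliplb : α4 * 2 ^ (ν + 1 + 2 ^ ν) ≤ lip) (hlipb : lip ≤ lipbar)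
    (hsmall : ((D : ℝ) + 1) * (2 * ε') * Real.exp (a'' * (ν + 1) + 2 ^ ν * (a₁ + Real.log 2)) * 2 ^ (ν + 1 + 2 ^ ν) ≤ a₁)
    (hfade : ω + 4 * lipbar * (a₁ * Real.exp (-(a'' * (ν + 1)))) * ((1 + cr * aA) * τbar) < 1) :
    16 * ((D : ℝ) + 1) * (2 ^ (ν + 1 + 2 ^ ν)) ^ 2 * 2 ^ (2 ^ ν) * α4 * ε' * τbar < 1 - ω :=
  fade_necessary_linProj_floor hα4 hε' hτbar ha₁ (one_le_readConst_mul_dirSize hrs hA haA hAj hnorm) hliplb hlipb hsmall hfade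

/-- **T⁴** (`ν = 4`, `D = 8`): with the floor, fading on E5′-P requires `144·2^58·α4·ε′·τ̄ < 1 − ω`. [folklore] -/
theorem fade_necessary_linProj_floor_T4 {a'' a₁ ε' α4 lip lipbar τbar ω c : ℝ} (hα4 : 0 ≤ α4) (hε' : 0 ≤ ε')
    (hτbar : 0 ≤ τbar) (ha₁ : 0 ≤ a₁) (hc1 : 1 ≤ c)
    (hliplb : α4 * 2 ^ ((4:ℕ) + 1 + 2 ^ (4:ℕ)) ≤ lip) (hlipb : lip ≤ lipbar)
    (hsmall : (((8:ℕ) : ℝ) + 1) * (2 * ε') * Real.exp (a'' * ((4:ℕ) + 1) + 2 ^ (4:ℕ) * (a₁ + Real.log 2)) *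
      2 ^ ((4:ℕ) + 1 + 2 ^ (4:ℕ)) ≤ a₁)
    (hfade : ω + 4 * lipbar * (a₁ * Real.exp (-(a'' * ((4:ℕ) + 1)))) * ((1 + c) * τbar) < 1) :
    144 * 2 ^ 58 * α4 * ε' * τbar < 1 - ω := by
  have h := fade_necessary_linProj_floor (ν := 4) (D := 8) hα4 hε' hτbar ha₁ hc1 hliplb hlipb hsmall hfade
  have e : (16:ℝ) * (((8:ℕ) : ℝ) + 1) * ((2:ℝ) ^ ((4:ℕ) + 1 + 2 ^ (4:ℕ))) ^ 2 * 2 ^ (2 ^ (4:ℕ)) = 144 * 2 ^ 58 := by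
    norm_num
  rw [e] at h
  exact h

/-- The T⁴ pure number of §2: `144·2^58 = 41505174165846491136` (vs N2-ter §B's `72·2^42` without projection and without the
`2^{2^ν}` of the prefactor slot). [folklore] -/
theorem T4_floor_constant : (144:ℝ) * 2 ^ 58 = 41505174165846491136 := by norm_num

/-! ## §3 Sufficient: N2-ter §B's joint satisfiability, at `(1 + c)·τ̄` -/

/-- **(P′) SUFFICIENCY ON E5′-P (kernel; N2-ter §B `fade_sufficient_lin` BY NAME at `τ̄ := (1+c)τ̄`, `ε := ε′2^{2^ν}`).**  Under
print's KP-type smallness shape `2^{ν+1}e(D+1)2^(ν+1+2^ν)·(ε′2^{2^ν})·e^{a″(ν+1)} ≤ 1` ([II] p. 18 «… exp 5κ ≤ 1», `5 = ν+1`) and the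
POLYNOMIAL product condition `8e(D+1)(2^(ν+1+2^ν))²·α4·(ε′2^{2^ν})·((1+c)τ̄) < 1 − ω` there are `a₁, lip, lipbar` meeting E5′-P's
`hsmall` (E5′ shape), `hliplb`, `hlipb` AND `μ_P < 1`. [cite: Balaban1988RG2Cluster, p.18 text] -/
theorem fade_sufficient_linProj {ν D : ℕ} {a'' ε' α4 τbar ω c : ℝ} (hε' : 0 ≤ ε') (hα4 : 0 < α4)
    (hKP : 2 ^ (ν + 1) * Real.exp 1 * ((D : ℝ) + 1) * 2 ^ (ν + 1 + 2 ^ ν) * (ε' * 2 ^ (2 ^ ν)) *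
      Real.exp (a'' * (ν + 1)) ≤ 1)
    (hprod : 8 * Real.exp 1 * ((D : ℝ) + 1) * (2 ^ (ν + 1 + 2 ^ ν)) ^ 2 * α4 * (ε' * 2 ^ (2 ^ ν)) * ((1 + c) * τbar) <
      1 - ω) :
    ∃ a₁ lip lipbar : ℝ, 0 ≤ a₁ ∧ 0 < lip ∧ lip ≤ lipbar ∧ α4 * 2 ^ (ν + 1 + 2 ^ ν) ≤ lip ∧
      ((D : ℝ) + 1) * (2 * ε') * Real.exp (a'' * (ν + 1) + 2 ^ ν * (a₁ + Real.log 2)) * 2 ^ (ν + 1 + 2 ^ ν) ≤ a₁ ∧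
      ω + 4 * lipbar * (a₁ * Real.exp (-(a'' * (ν + 1)))) * ((1 + c) * τbar) < 1 := by
  obtain ⟨a₁, lip, lipbar, ha₁, hlip, hlipb, hliplb, hsmall, hfade⟩ :=
    fade_sufficient_lin (τbar := (1 + c) * τbar) (by positivity : 0 ≤ ε' * 2 ^ (2 ^ ν)) hα4 hKP hprod
  exact ⟨a₁, lip, lipbar, ha₁, hlip, hlipb, hliplb, linSmall_iff.2 hsmall, hfade⟩

/-! ## §4 The census §8 reading («κ sufficiently large») with the factor `(1 + c)` -/

/-- **FADING OF `μ_P` ⟺ THE PRODUCT IS BELOW `(1 − ω)·e^{x}`** (`x = a″(ν+1)`; kernel). [folklore] -/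
theorem fade_linProj_iff_lt_exp (ω lipbar a₁ c τbar x : ℝ) :
    ω + 4 * lipbar * (a₁ * Real.exp (-x)) * ((1 + c) * τbar) < 1 ↔
      4 * lipbar * a₁ * ((1 + c) * τbar) < (1 - ω) * Real.exp x := by
  have hE : 0 < Real.exp x := Real.exp_pos x
  have key : ω + 4 * lipbar * (a₁ * Real.exp (-x)) * ((1 + c) * τbar) =
      ω + (4 * lipbar * a₁ * ((1 + c) * τbar)) / Real.exp x := by
    rw [Real.exp_neg, div_eq_mul_inv]; ring
  rw [key]
  constructor
  · intro h
    have h1 : (4 * lipbar * a₁ * ((1 + c) * τbar)) / Real.exp x < 1 - ω := by linarith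
    rwa [div_lt_iff₀ hE] at h1
  · intro h
    have h1 : (4 * lipbar * a₁ * ((1 + c) * τbar)) / Real.exp x < 1 - ω := by rwa [div_lt_iff₀ hE]
    linarith

/-- **THE THRESHOLD FORM: for `ω < 1` and a positive product `Π = 4·lipbar·a₁·((1+c)τ̄)`, `μ_P < 1 ↔ log(Π∕(1 − ω)) < x`**
(`x = a″(ν+1)`): a LOWER bound on the decay-weight rate — TYPE «κ sufficiently large» ([I] Thm 3 p. 264 «κ ≥ κ₀»; [II] p. 18);
the (w10) factor enters under the logarithm. [cite: Balaban1987RG1, Thm 3 p.264; Balaban1988RG2Cluster, p.18 text] -/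
theorem fade_linProj_iff_log_lt {ω lipbar a₁ c τbar : ℝ} (x : ℝ) (hω : ω < 1)
    (hprod : 0 < 4 * lipbar * a₁ * ((1 + c) * τbar)) :
    ω + 4 * lipbar * (a₁ * Real.exp (-x)) * ((1 + c) * τbar) < 1 ↔
      Real.log (4 * lipbar * a₁ * ((1 + c) * τbar) / (1 - ω)) < x := by
  have h1ω : 0 < 1 - ω := by linarith
  rw [fade_linProj_iff_lt_exp, Real.log_lt_iff_lt_exp (div_pos hprod h1ω), div_lt_iff₀ h1ω, mul_comm (Real.exp x)]

/-- **THE THRESHOLD SPLITS ADDITIVELY**: `log(Π_c∕(1−ω)) = log(Π₀∕(1−ω)) + log(1+c)` (`Π₀` the product without the factor) — the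
(w10) factor costs `+ log(1+c)` on `a″(ν+1)` (at the floor `c = 1` on T⁴: `+ (log 2)∕5` on `a″`). [folklore] -/
theorem logThreshold_split {ω lipbar a₁ c τbar : ℝ} (hω : ω < 1) (hprod0 : 0 < 4 * lipbar * a₁ * τbar) (hc : 0 ≤ c) :
    Real.log (4 * lipbar * a₁ * ((1 + c) * τbar) / (1 - ω)) =
      Real.log (4 * lipbar * a₁ * τbar / (1 - ω)) + Real.log (1 + c) := by
  have h1ω : 0 < 1 - ω := by linarith
  have e : 4 * lipbar * a₁ * ((1 + c) * τbar) / (1 - ω) = (4 * lipbar * a₁ * τbar / (1 - ω)) * (1 + c) := by ring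
  rw [e, Real.log_mul (div_pos hprod0 h1ω).ne' (by linarith : (1 + c) ≠ 0)]

/-- `(log 2)∕5 < 0.139` — the T⁴ shift of the `a″`-threshold at the floor `c = 1`. [folklore] -/
theorem log_two_div_five_lt : Real.log 2 / 5 < 0.139 := by
  have := Real.log_two_lt_d9
  linarith

/-- **MONOTONE IN THE DECAY-WEIGHT RATE**: fading at `x` persists at every `x′ ≥ x` (nonnegative letters). [folklore] -/
theorem fade_linProj_mono {ω lipbar a₁ c τbar x x' : ℝ} (hlip : 0 ≤ lipbar) (ha₁ : 0 ≤ a₁) (hc : 0 ≤ c)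
    (hτbar : 0 ≤ τbar) (hxx : x ≤ x')
    (h : ω + 4 * lipbar * (a₁ * Real.exp (-x)) * ((1 + c) * τbar) < 1) :
    ω + 4 * lipbar * (a₁ * Real.exp (-x')) * ((1 + c) * τbar) < 1 := by
  have hE : Real.exp (-x') ≤ Real.exp (-x) := Real.exp_le_exp.2 (by linarith)
  have hm : 4 * lipbar * (a₁ * Real.exp (-x')) * ((1 + c) * τbar) ≤
      4 * lipbar * (a₁ * Real.exp (-x)) * ((1 + c) * τbar) := by
    have h1 : a₁ * Real.exp (-x') ≤ a₁ * Real.exp (-x) := mul_le_mul_of_nonneg_left hE ha₁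
    have h2 : 0 ≤ (1 + c) * τbar := mul_nonneg (by linarith) hτbar
    exact mul_le_mul_of_nonneg_right (mul_le_mul_of_nonneg_left h1 (by linarith)) h2
  linarith

/-- **«κ SUFFICIENTLY LARGE» SUFFICES ON E5′-P (kernel)**: with the face's ADDITIVE rate binder `κ ≤ a″`, the threshold
`log(Π∕(1−ω)) < κ·(ν+1)` already gives `μ_P < 1` — print's «exp 5κ» mechanism ([II] p. 18, `ν + 1 = 5`) read on the projected
face; NO condition on `M`, NO ε₁-smallness beyond `hsmall`. [cite: Balaban1988RG2Cluster, p.18 text; Balaban1987RG1, Thm 3 p.264] -/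
theorem fade_linProj_of_kappa_threshold {ν : ℕ} {ω lipbar a₁ c τbar κ a'' : ℝ} (hω : ω < 1) (hlip : 0 ≤ lipbar)
    (ha₁ : 0 ≤ a₁) (hc : 0 ≤ c) (hτbar : 0 ≤ τbar) (hprod : 0 < 4 * lipbar * a₁ * ((1 + c) * τbar)) (hκa : κ ≤ a'')
    (hthr : Real.log (4 * lipbar * a₁ * ((1 + c) * τbar) / (1 - ω)) < κ * (ν + 1)) :
    ω + 4 * lipbar * (a₁ * Real.exp (-(a'' * (ν + 1)))) * ((1 + c) * τbar) < 1 :=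
  fade_linProj_mono hlip ha₁ hc hτbar (mul_le_mul_of_nonneg_right hκa (by positivity))
    ((fade_linProj_iff_log_lt (κ * (ν + 1)) hω hprod).2 hthr)

/-- **THE FLOOR PRODUCT IS M-UNIFORM UNDER THE LOCATED SHAPES** (census (V1)/(V2) question of (w10)'s rider, read on E5′-P): if
`lipbar = α4·2^(ν+1+2^ν)` sits at its floor with `α4 ≤ α̂·((L·M)⁴)⁻¹` ([II] p. 20 «(LM)⁴α₄ … bounded by 1», SHAPE) and the projection
cost obeys `c ≤ C·M⁴` (the M⁴-reading (V2); (V1) is `C·M⁴ ↦ C`), then for `M ≥ 1`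
`4·lipbar·a₁·((1+c)τ̄) ≤ 4·(α̂·2^(ν+1+2^ν))·a₁·((1+C)τ̄)·(L⁴)⁻¹` — M-FREE: the κ-threshold of `fade_linProj_iff_log_lt` does not grow
with `M`, so print's order of choices «κ ≥ κ₀, then M ≥ M(κ)» ([I] Thm 3 p. 264) is respected under either reading.
[cite: Balaban1988RG2Cluster, p.20 text; Balaban1987RG1, Thm 3 p.264] -/
theorem floorProduct_M_uniform {ν : ℕ} {α4 αhat L M a₁ c C τbar : ℝ} (hL : 0 < L) (hM : 1 ≤ M) (hα40 : 0 ≤ α4)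
    (hc0 : 0 ≤ c) (ha₁ : 0 ≤ a₁) (hτbar : 0 ≤ τbar) (hC : 0 ≤ C) (hα4 : α4 ≤ αhat * ((L * M) ^ 4)⁻¹)
    (hc : c ≤ C * M ^ 4) :
    4 * (α4 * 2 ^ (ν + 1 + 2 ^ ν)) * a₁ * ((1 + c) * τbar) ≤
      4 * (αhat * 2 ^ (ν + 1 + 2 ^ ν)) * a₁ * ((1 + C) * τbar) * (L ^ 4)⁻¹ := by
  have hM0 : 0 < M := by linarith
  have hM4 : 1 ≤ M ^ 4 := one_le_pow₀ hM
  have hL4 : 0 < L ^ 4 := by positivity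
  have hM4pos : 0 < M ^ 4 := by positivity
  have hαhat : 0 ≤ αhat := by
    have : 0 ≤ αhat * ((L * M) ^ 4)⁻¹ := hα40.trans hα4
    have hinv : 0 < ((L * M) ^ 4)⁻¹ := by positivity
    nlinarith
  -- `α4·(1+c) ≤ α̂·(LM)⁻⁴·(1 + C·M⁴) = α̂·L⁻⁴·(M⁻⁴ + C) ≤ α̂·(1+C)·L⁻⁴`
  have h1 : α4 * (1 + c) ≤ αhat * ((L * M) ^ 4)⁻¹ * (1 + C * M ^ 4) :=
    mul_le_mul hα4 (by linarith) (by linarith) (by positivity)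
  have h2 : αhat * ((L * M) ^ 4)⁻¹ * (1 + C * M ^ 4) = αhat * (L ^ 4)⁻¹ * ((M ^ 4)⁻¹ + C) := by
    field_simp
  have h3 : αhat * (L ^ 4)⁻¹ * ((M ^ 4)⁻¹ + C) ≤ αhat * (L ^ 4)⁻¹ * (1 + C) :=
    mul_le_mul_of_nonneg_left (by linarith [inv_le_one_of_one_le₀ hM4]) (by positivity)
  have h123 : α4 * (1 + c) ≤ αhat * (L ^ 4)⁻¹ * (1 + C) := h1.trans (h2.le.trans h3)
  have hw : 0 ≤ 4 * (2:ℝ) ^ (ν + 1 + 2 ^ ν) * a₁ * τbar := by positivity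
  calc 4 * (α4 * 2 ^ (ν + 1 + 2 ^ ν)) * a₁ * ((1 + c) * τbar)
      = (α4 * (1 + c)) * (4 * 2 ^ (ν + 1 + 2 ^ ν) * a₁ * τbar) := by ring
    _ ≤ (αhat * (L ^ 4)⁻¹ * (1 + C)) * (4 * 2 ^ (ν + 1 + 2 ^ ν) * a₁ * τbar) := mul_le_mul_of_nonneg_right h123 hw
    _ = 4 * (αhat * 2 ^ (ν + 1 + 2 ^ ν)) * a₁ * ((1 + C) * τbar) * (L ^ 4)⁻¹ := by ring

end Summit.QuantumFields.BalabanUV.T4Continuum.NE9FadingArithmeticLinProj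

end
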